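import Summits.BirchSwinnertonDyer.BirchSwinnertonDyer.Theorems.PrintCFramBottomClassIndexLawFiveLeBorelOStructure
import HarnessLib

/-!
# Route `PrintCFram`, crux C2 `BottomClassIndexLawFiveLe` (stmt-BirchSwinnertonDyer-20372), line
# `eisenstein-resource-bdp-line` (S2 `stub_kolyvaginUpper_borelCM_pairSum`): GENERIC UNISERIALITY — the `μ`-stable
# subgroups of `A[p^M] = ℤv + ℤμv` (`μ ∘ μ = [m]`, `|m| = p`) are exactly the layers `μ^j(A[p^M])`, `j = 0…2M`
# (cell `bsd-print-cfram`, seat `bsd-line-cfram-p1-w4` g3; helper `--supports` 20372; 0 facts, 0 defs)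

HONEST FRAMING. Nothing about BSD is proved here. Pure algebra serving the sequel `…BorelStableLayers.lean`
(`W[p^M]` is uniserial under `Γ_K` on the Borel CM-ramified class): for an abelian group `A` with an additive
`μ`, `μ ∘ μ = [m]`, `|m| = p` prime, and `T = A[p^M]` generated by `v, μv` (the output of w2 g5's
`BorelHomothety.exists_generator_pair`, i.e. `T ≅ (ℤ/p^M)[μ] ≅ 𝓞/𝔭^{2M}` cyclic), the `2M + 1` LAYERS
`Λ_j = μ^j(T)` (written definition-free as `(AddSubgroup.torsionBy A (p^M)).map (μ ^ j)`) satisfy: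
`Λ_{j+1} ≤ Λ_j` (`map_pow_succ_le`, `map_pow_le_of_le`), `Λ_{2M} = 0` (`map_pow_two_mul_eq_bot`),
`Λ_j = ℤμ^j v + Λ_{j+1}` (`exists_of_mem_map_pow`), and the KEY descent (`map_pow_le_sup_of_mem`, `map_pow_le_of_mem`):
a `μ`-stable `H` containing a point of `Λ_j ∖ Λ_{j+1}` contains `Λ_j` (the point is `a·μ^j v + R`, `p ∤ a`, `a`
invertible mod `p^M`; then `Λ_j ≤ H + Λ_{j+1}`, and applying `μ^k` along the chain, `Λ_j ≤ H + Λ_{2M} = H` —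
Nakayama without counting). Hence **`exists_eq_map_pow_of_stable`** (every `μ`-stable `H ≤ T` is a layer),
**`le_or_le_of_stable`** (the `μ`-stable subgroups are totally ordered).

THEOREMS ONLY; no definition, no named fact, no `sorry`; imports no `Theses` module. BSD is not proved by any of
this; no summit statement is proved by this seat.
References: [Rubin1999] Prop. 5.4, Cor. 5.5 (E[𝔭ⁿ] ≅ 𝒪/𝔭ⁿ is cyclic; its submodules are the 𝔭-powers);
[AtiyahMacdonald1969] Prop. 2.6 (Nakayama).
-/

set_option autoImplicit false
-- `…BirchSwinnertonDyer.BirchSwinnertonDyer.Theorems…` is the problem's mandated namespace (D-0017).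
set_option linter.dupNamespace false

namespace Summit.BirchSwinnertonDyer.BirchSwinnertonDyer.Theorems.PrintCFram.BorelNonScalar

open Summit.BirchSwinnertonDyer.BirchSwinnertonDyer.Theorems.PrintCFram.BorelHomothety

/-! ## The layers `μ^j(A[p^M])` of a cyclic `(ℤ/p^M)[μ]`-module -/

section Generic

variable {A : Type*} [AddCommGroup A] (μ : AddMonoid.End A) {m : ℤ} {p M : ℕ}

/-- `μ^{j+1} P = μ^j (μ P)`. [folklore] -/
theorem end_pow_succ_apply_right (j : ℕ) (P : A) : (μ ^ (j + 1)) P = (μ ^ j) (μ P) := by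
  rw [pow_succ, AddMonoid.End.coe_mul, Function.comp_apply]

/-- `μ^{j+1} P = μ (μ^j P)`. [folklore] -/
theorem end_pow_succ_apply_left (j : ℕ) (P : A) : (μ ^ (j + 1)) P = μ ((μ ^ j) P) := by
  rw [pow_succ', AddMonoid.End.coe_mul, Function.comp_apply]

/-- `μ^j` maps `A[n]` into `A[n]`. [folklore] -/
theorem pow_apply_mem_torsionBy (j : ℕ) {n : ℕ} {P : A} (hP : P ∈ AddSubgroup.torsionBy A (n : ℤ)) :
    (μ ^ j) P ∈ AddSubgroup.torsionBy A (n : ℤ) := by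
  induction j with
  | zero => simpa using hP
  | succ j ih =>
    rw [end_pow_succ_apply_left]
    exact apply_mem_torsionBy (μ : A →+ A) ih

/-- The layers decrease: `μ^{j+1}(A[n]) ≤ μ^j(A[n])`. [folklore] -/
theorem map_pow_succ_le (j n : ℕ) :
    (AddSubgroup.torsionBy A (n : ℤ)).map ((μ ^ (j + 1) : AddMonoid.End A) : A →+ A) ≤
      (AddSubgroup.torsionBy A (n : ℤ)).map ((μ ^ j : AddMonoid.End A) : A →+ A) := by
  rintro x ⟨P, hP, rfl⟩
  refine ⟨μ P, apply_mem_torsionBy (μ : A →+ A) hP, ?_⟩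
  change (μ ^ j) (μ P) = (μ ^ (j+1)) P
  rw [end_pow_succ_apply_right]

/-- The layers decrease: `i ≤ j ⟹ μ^j(A[n]) ≤ μ^i(A[n])`. [folklore] -/
theorem map_pow_le_of_le {i j : ℕ} (hij : i ≤ j) (n : ℕ) :
    (AddSubgroup.torsionBy A (n : ℤ)).map ((μ ^ j : AddMonoid.End A) : A →+ A) ≤
      (AddSubgroup.torsionBy A (n : ℤ)).map ((μ ^ i : AddMonoid.End A) : A →+ A) := by
  induction hij with
  | refl => exact le_rfl
  | step _ ih => exact (map_pow_succ_le μ _ n).trans ih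



/-- `μ^{2k} P = m^k • P`. [folklore] -/
theorem pow_two_mul_apply (hμμ : ∀ P, μ (μ P) = m • P) (k : ℕ) (P : A) :
    (μ ^ (2 * k)) P = (m ^ k) • P := by
  induction k with
  | zero => simp
  | succ k ih =>
    rw [show 2 * (k + 1) = (2 * k + 1) + 1 by ring, end_pow_succ_apply_left, end_pow_succ_apply_left, ih, map_zsmul, map_zsmul,
      hμμ, smul_smul, pow_succ, mul_comm]

/-- The top layer vanishes: `μ^{2M}(A[p^M]) = 0` (`μ^{2M} = [m^M]`, `|m|^M = p^M`). [folklore] -/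
theorem map_pow_two_mul_eq_bot (hμμ : ∀ P, μ (μ P) = m • P) (hm : m.natAbs = p) :
    (AddSubgroup.torsionBy A ((p ^ M : ℕ) : ℤ)).map ((μ ^ (2 * M) : AddMonoid.End A) : A →+ A) = ⊥ := by
  rw [eq_bot_iff]
  rintro x ⟨P, hP, rfl⟩
  rw [AddSubgroup.mem_bot]
  change (μ ^ (2 * M)) P = 0
  rw [pow_two_mul_apply μ hμμ]
  have h : (m ^ M).natAbs • P = 0 := by
    rw [Int.natAbs_pow, hm]
    exact AddSubgroup.torsionBy.nsmul_iff.mp hP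
  exact natAbs_nsmul_eq_zero.mp h

/-- Layers compose: `μ^{j+k}(T) = μ^k(μ^j(T))`. [folklore] -/
theorem map_pow_add (j k n : ℕ) :
    (AddSubgroup.torsionBy A (n : ℤ)).map ((μ ^ (j + k) : AddMonoid.End A) : A →+ A) =
      ((AddSubgroup.torsionBy A (n : ℤ)).map ((μ ^ j : AddMonoid.End A) : A →+ A)).map
        ((μ ^ k : AddMonoid.End A) : A →+ A) := by
  rw [AddSubgroup.map_map]
  congr 1
  rw [add_comm, pow_add]
  rfl

/-- A `μ`-stable subgroup is `μ^k`-stable: `μ^k(H) ≤ H`. [folklore] -/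
theorem map_pow_le_of_stable {H : AddSubgroup A} (hH : ∀ P ∈ H, μ P ∈ H) (k : ℕ) :
    H.map ((μ ^ k : AddMonoid.End A) : A →+ A) ≤ H := by
  induction k with
  | zero =>
    rintro x ⟨P, hP, rfl⟩
    change (μ ^ 0) P ∈ H
    rwa [pow_zero, AddMonoid.End.coe_one, id_eq]
  | succ k ih =>
    rintro x ⟨P, hP, rfl⟩
    change (μ ^ (k + 1)) P ∈ H
    rw [end_pow_succ_apply_left]
    exact hH _ (ih ⟨P, hP, rfl⟩)

/-- Generator form of a layer: with `A[p^M] = ℤv + ℤμv`, every `x ∈ μ^j(A[p^M])` is `a • μ^j v + R` with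
`R ∈ μ^{j+1}(A[p^M])`. [folklore] -/
theorem exists_of_mem_map_pow {v : A} (hv : v ∈ AddSubgroup.torsionBy A ((p ^ M : ℕ) : ℤ))
    (hgen : ∀ P ∈ AddSubgroup.torsionBy A ((p ^ M : ℕ) : ℤ), ∃ a b : ℤ, P = a • v + b • μ v)
    {j : ℕ} {x : A} (hx : x ∈ (AddSubgroup.torsionBy A ((p ^ M : ℕ) : ℤ)).map ((μ ^ j : AddMonoid.End A) : A →+ A)) :
    ∃ a : ℤ, ∃ R ∈ (AddSubgroup.torsionBy A ((p ^ M : ℕ) : ℤ)).map ((μ ^ (j + 1) : AddMonoid.End A) : A →+ A),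
      x = a • (μ ^ j) v + R := by
  obtain ⟨P, hP, rfl⟩ := hx
  obtain ⟨a, b, rfl⟩ := hgen P hP
  have hmem : (μ ^ (j + 1)) v ∈
      (AddSubgroup.torsionBy A ((p ^ M : ℕ) : ℤ)).map ((μ ^ (j + 1) : AddMonoid.End A) : A →+ A) := ⟨v, hv, rfl⟩
  refine ⟨a, b • (μ ^ (j + 1)) v, AddSubgroup.zsmul_mem _ hmem b, ?_⟩
  change (μ ^ j) (a • v + b • μ v) = _
  rw [map_add, map_zsmul, map_zsmul, end_pow_succ_apply_right]



/-- **Key step.** If a `μ`-stable subgroup `H` contains a point of `μ^j(A[p^M])` outside `μ^{j+1}(A[p^M])`, then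
`μ^j(A[p^M]) ≤ H + μ^{j+1}(A[p^M])` (the point is `a·μ^j v + R` with `p ∤ a`, and `a` is invertible modulo
`p^M`). [folklore] -/
theorem map_pow_le_sup_of_mem (hμμ : ∀ P, μ (μ P) = m • P) (hm : m.natAbs = p) (hp : p.Prime)
    {v : A} (hv : v ∈ AddSubgroup.torsionBy A ((p ^ M : ℕ) : ℤ))
    (hgen : ∀ P ∈ AddSubgroup.torsionBy A ((p ^ M : ℕ) : ℤ), ∃ a b : ℤ, P = a • v + b • μ v)
    {H : AddSubgroup A} {j : ℕ} {P : A} (hPH : P ∈ H)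
    (hPj : P ∈ (AddSubgroup.torsionBy A ((p ^ M : ℕ) : ℤ)).map ((μ ^ j : AddMonoid.End A) : A →+ A))
    (hPj1 : P ∉ (AddSubgroup.torsionBy A ((p ^ M : ℕ) : ℤ)).map ((μ ^ (j + 1) : AddMonoid.End A) : A →+ A)) :
    (AddSubgroup.torsionBy A ((p ^ M : ℕ) : ℤ)).map ((μ ^ j : AddMonoid.End A) : A →+ A) ≤
      H ⊔ (AddSubgroup.torsionBy A ((p ^ M : ℕ) : ℤ)).map ((μ ^ (j + 1) : AddMonoid.End A) : A →+ A) := by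
  set T := AddSubgroup.torsionBy A ((p ^ M : ℕ) : ℤ) with hT
  set Λ₁ := T.map ((μ ^ (j + 1) : AddMonoid.End A) : A →+ A) with hΛ₁
  obtain ⟨a, R, hR, hPeq⟩ := exists_of_mem_map_pow μ hv hgen hPj
  set w : A := (μ ^ j) v with hw
  have hwT : w ∈ T := pow_apply_mem_torsionBy μ j hv
  -- `p • w ∈ Λ₁` (as `p = ±m` and `m • w = μ^{j+2} v`)
  have hmw : m • w ∈ Λ₁ := by
    have h2 : (μ ^ (j + 2)) v ∈ T.map ((μ ^ (j + 2) : AddMonoid.End A) : A →+ A) := ⟨v, hv, rfl⟩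
    have h2' := map_pow_succ_le μ (j + 1) (p ^ M) h2
    rw [← hμμ, hw, ← end_pow_succ_apply_left, ← end_pow_succ_apply_left]
    exact h2'
  have hpw : (p : ℤ) • w ∈ Λ₁ := by
    rcases Int.natAbs_eq m with h | h <;> rw [hm] at h
    · rw [← h]; exact hmw
    · have : (p : ℤ) = -m := by rw [h, neg_neg]
      rw [this, neg_smul]
      exact neg_mem hmw
  -- `p ∤ a`
  have hpa : ¬ (p : ℤ) ∣ a := by
    rintro ⟨a', rfl⟩
    apply hPj1
    rw [hPeq, mul_comm, ← smul_smul]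
    exact add_mem (AddSubgroup.zsmul_mem _ hpw a') hR
  -- `a` is invertible modulo `p^M`: `x p^M + c a = 1`
  have hcop : IsCoprime ((p : ℤ) ^ M) a :=
    (((Nat.prime_iff_prime_int.mp hp).coprime_iff_not_dvd).mpr hpa).pow_left
  obtain ⟨x, c, hxc⟩ := hcop
  have hw_eq : w = c • P - c • R := by
    have hpMw : ((p : ℤ) ^ M) • w = 0 := by
      have := AddSubgroup.torsionBy.nsmul_iff.mp hwT
      rw [← natCast_zsmul] at this
      exact_mod_cast this
    calc w = (x * (p : ℤ) ^ M + c * a) • w := by rw [hxc, one_smul]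
      _ = x • (((p : ℤ) ^ M) • w) + c • (a • w) := by rw [add_smul, mul_smul, mul_smul]
      _ = c • (P - R) := by rw [hpMw, smul_zero, zero_add, hPeq, add_sub_cancel_right]
      _ = c • P - c • R := smul_sub c P R
  have hwmem : w ∈ H ⊔ Λ₁ := by
    rw [hw_eq]
    exact sub_mem (AddSubgroup.mem_sup_left (AddSubgroup.zsmul_mem _ hPH c))
      (AddSubgroup.mem_sup_right (AddSubgroup.zsmul_mem _ hR c))
  intro x hx
  obtain ⟨a₁, R₁, hR₁, rfl⟩ := exists_of_mem_map_pow μ hv hgen hx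
  exact add_mem (AddSubgroup.zsmul_mem _ hwmem a₁) (AddSubgroup.mem_sup_right hR₁)

/-- **Descent.** Under the hypotheses of `map_pow_le_sup_of_mem`: `μ^j(A[p^M]) ≤ H` (iterate along the chain down to
`μ^{2M}(A[p^M]) = 0`). [folklore] -/
theorem map_pow_le_of_mem (hμμ : ∀ P, μ (μ P) = m • P) (hm : m.natAbs = p) (hp : p.Prime)
    {v : A} (hv : v ∈ AddSubgroup.torsionBy A ((p ^ M : ℕ) : ℤ))
    (hgen : ∀ P ∈ AddSubgroup.torsionBy A ((p ^ M : ℕ) : ℤ), ∃ a b : ℤ, P = a • v + b • μ v)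
    {H : AddSubgroup A} (hH : ∀ P ∈ H, μ P ∈ H) {j : ℕ} {P : A} (hPH : P ∈ H)
    (hPj : P ∈ (AddSubgroup.torsionBy A ((p ^ M : ℕ) : ℤ)).map ((μ ^ j : AddMonoid.End A) : A →+ A))
    (hPj1 : P ∉ (AddSubgroup.torsionBy A ((p ^ M : ℕ) : ℤ)).map ((μ ^ (j + 1) : AddMonoid.End A) : A →+ A)) :
    (AddSubgroup.torsionBy A ((p ^ M : ℕ) : ℤ)).map ((μ ^ j : AddMonoid.End A) : A →+ A) ≤ H := by
  set T := AddSubgroup.torsionBy A ((p ^ M : ℕ) : ℤ) with hT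
  have base := map_pow_le_sup_of_mem μ hμμ hm hp hv hgen (H := H) hPH hPj hPj1
  have step : ∀ k : ℕ, T.map ((μ ^ j : AddMonoid.End A) : A →+ A) ≤
      H ⊔ T.map ((μ ^ (j + 1 + k) : AddMonoid.End A) : A →+ A) := by
    intro k
    induction k with
    | zero => rw [Nat.add_zero]; exact base
    | succ k ih =>
      have h1 : T.map ((μ ^ (j + 1 + k) : AddMonoid.End A) : A →+ A) ≤
          H ⊔ T.map ((μ ^ (j + 1 + (k + 1)) : AddMonoid.End A) : A →+ A) := by
        rw [show j + 1 + k = j + (1 + k) by ring, map_pow_add μ j (1 + k),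
          show j + 1 + (k + 1) = (j + 1) + (1 + k) by ring, map_pow_add μ (j + 1) (1 + k)]
        refine (AddSubgroup.map_mono base).trans ?_
        rw [AddSubgroup.map_sup]
        exact sup_le_sup_right (map_pow_le_of_stable μ hH (1 + k)) _
      exact ih.trans (sup_le le_sup_left h1)
  have hbot : T.map ((μ ^ (j + 1 + 2 * M) : AddMonoid.End A) : A →+ A) = ⊥ := by
    rw [eq_bot_iff, ← map_pow_two_mul_eq_bot μ hμμ hm (M := M)]
    exact map_pow_le_of_le μ (by omega) (p ^ M)
  have h := step (2 * M)
  rw [hbot, sup_bot_eq] at h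
  exact h

/-- **Every `μ`-stable subgroup of `A[p^M]` is a layer `μ^j(A[p^M])`, `j ≤ 2M`.** [folklore] -/
theorem exists_eq_map_pow_of_stable (hμμ : ∀ P, μ (μ P) = m • P) (hm : m.natAbs = p) (hp : p.Prime)
    {v : A} (hv : v ∈ AddSubgroup.torsionBy A ((p ^ M : ℕ) : ℤ))
    (hgen : ∀ P ∈ AddSubgroup.torsionBy A ((p ^ M : ℕ) : ℤ), ∃ a b : ℤ, P = a • v + b • μ v)
    {H : AddSubgroup A} (hHT : H ≤ AddSubgroup.torsionBy A ((p ^ M : ℕ) : ℤ)) (hH : ∀ P ∈ H, μ P ∈ H) :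
    ∃ j ≤ 2 * M, H = (AddSubgroup.torsionBy A ((p ^ M : ℕ) : ℤ)).map ((μ ^ j : AddMonoid.End A) : A →+ A) := by
  classical
  set T := AddSubgroup.torsionBy A ((p ^ M : ℕ) : ℤ) with hT
  have h0 : H ≤ T.map ((μ ^ 0 : AddMonoid.End A) : A →+ A) := by
    rw [pow_zero]
    change H ≤ T.map (AddMonoidHom.id A)
    rwa [AddSubgroup.map_id]
  set j₀ := Nat.findGreatest (fun j => H ≤ T.map ((μ ^ j : AddMonoid.End A) : A →+ A)) (2 * M) with hj₀
  have hj₀spec : H ≤ T.map ((μ ^ j₀ : AddMonoid.End A) : A →+ A) :=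
    Nat.findGreatest_spec (P := fun j => H ≤ T.map ((μ ^ j : AddMonoid.End A) : A →+ A)) (Nat.zero_le _) h0
  refine ⟨j₀, Nat.findGreatest_le _, le_antisymm hj₀spec ?_⟩
  by_cases hex : ∃ P ∈ H, P ∉ T.map ((μ ^ (j₀ + 1) : AddMonoid.End A) : A →+ A)
  · obtain ⟨P, hPH, hP1⟩ := hex
    exact map_pow_le_of_mem μ hμμ hm hp hv hgen hH hPH (hj₀spec hPH) hP1
  · push Not at hex
    have hle : H ≤ T.map ((μ ^ (j₀ + 1) : AddMonoid.End A) : A →+ A) := fun P hP => hex P hP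
    by_cases hj : j₀ + 1 ≤ 2 * M
    · exact absurd hle (Nat.findGreatest_is_greatest (Nat.lt_succ_self _) hj)
    · have hj' : 2 * M ≤ j₀ := by omega
      refine (map_pow_le_of_le μ hj' (p ^ M)).trans ?_
      rw [map_pow_two_mul_eq_bot μ hμμ hm]
      exact bot_le

/-- **The `μ`-stable subgroups of `A[p^M]` are totally ordered.** [folklore] -/
theorem le_or_le_of_stable (hμμ : ∀ P, μ (μ P) = m • P) (hm : m.natAbs = p) (hp : p.Prime)
    {v : A} (hv : v ∈ AddSubgroup.torsionBy A ((p ^ M : ℕ) : ℤ))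
    (hgen : ∀ P ∈ AddSubgroup.torsionBy A ((p ^ M : ℕ) : ℤ), ∃ a b : ℤ, P = a • v + b • μ v)
    {H₁ H₂ : AddSubgroup A} (h₁T : H₁ ≤ AddSubgroup.torsionBy A ((p ^ M : ℕ) : ℤ)) (h₁ : ∀ P ∈ H₁, μ P ∈ H₁)
    (h₂T : H₂ ≤ AddSubgroup.torsionBy A ((p ^ M : ℕ) : ℤ)) (h₂ : ∀ P ∈ H₂, μ P ∈ H₂) :
    H₁ ≤ H₂ ∨ H₂ ≤ H₁ := by
  obtain ⟨j₁, -, rfl⟩ := exists_eq_map_pow_of_stable μ hμμ hm hp hv hgen h₁T h₁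
  obtain ⟨j₂, -, rfl⟩ := exists_eq_map_pow_of_stable μ hμμ hm hp hv hgen h₂T h₂
  rcases le_total j₁ j₂ with h | h
  · exact Or.inr (map_pow_le_of_le μ h (p ^ M))
  · exact Or.inl (map_pow_le_of_le μ h (p ^ M))

end Generic

end Summit.BirchSwinnertonDyer.BirchSwinnertonDyer.Theorems.PrintCFram.BorelNonScalar
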